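import Summits.MatrixMultiplication.MatrixMultiplication.Theorems.SoloInformedTwistedMatchingsExponent
import Summits.MatrixMultiplication.MatrixMultiplication.Theorems.SoloInformedTwistedMatchingsBehrend
import HarnessLib

/-!
# Theorem B″ (kernel form): translation schemes over abelian groups of bounded exponent are
# polynomially wasteful for `⟨n,n,n⟩`

Solo-informed seat (MatrixMultiplication), gen 101 — the headline of sharpest-statement §2y(8),
assembled from `realization_expTwisted_inducedMatching_card_le` (twisted slice rank over the
largest primary component; every finite abelian group of exponent dividing `m`; arbitrary
automorphism-pair twists) and `threeAPFree_inducedMatching` + Behrend (Mathlib):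

`realization_exp_card_ge_behrend` — for every `m ≥ 1` there is `δ = δ(m) > 0` such that if
`α, β, γ : [3N]² → S` realize `⟨3N,3N,3N⟩` in the sense of Cohn–Umans 2013, Def. 12, for the
twisted triangle predicate `∃ s, α(x)·φ_s(β(y))·ψ_s(γ(z)) = 1` of a finite family of automorphism
pairs of a finite abelian group `S` with `g^m = 1`, then `N² e^{-4√(log N)} ≤ 3 |S|^{1-δ}`.

Reading (CU13 §5): the translation scheme `𝒮(S, M₀)`, `M₀ ≤ Aut S`, has rank `≥ |S|/|M₀|`, and
`ω = 2` via Conj. 21 along such schemes needs realizations of `⟨n,n,n⟩` with rank `n^{2+o(1)}`;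
by the theorem `|S| ≥ n^{(2-o(1))/(1-δ(m))}`, so in bounded exponent this forces
`|M₀| ≥ |S|^{δ(m)-o(1)}` — large, necessarily non-central twisting. The abelian-group programme
(`M₀ = 1`), its cyclic-twist variants and all "few multipliers" translation schemes over hosts of
bounded exponent are thereby excluded; unbounded exponent (e.g. `ℤ/p^k`, `k → ∞`, or char `→ ∞`)
and non-translation schemes remain open (sharpest-statement §2y(8), clauses (d)–(f)).
References: CohnUmans2013 (arXiv:1207.6528) Def. 12, Thm. 17, §5, Conj. 21;
BlasiakChurchCohnGrochowUmans2017 (arXiv:1712.02302) Thm. 3.11; Behrend (1946).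
-/

noncomputable section

open scoped BigOperators
open Finset Literature.Combinatorics.Additive Literature.Barriers.MatrixMultiplication

namespace Summit.MatrixMultiplication.MatrixMultiplication.Theorems.TwistedSliceRank

section Headline

/-- **Roth form, bounded exponent.** With `δ = δ(m) > 0`: a Cohn–Umans realization of
`⟨3N,3N,3N⟩` by the twisted triangle predicate of finitely many automorphism pairs of a finite
abelian group `S` with `g^m = 1` forces `r₃(N)·N ≤ 3|S|^{1-δ}`. [this work] -/
theorem realization_exp_card_ge_roth (m : ℕ) (hm : 0 < m) :
    ∃ δ : ℝ, 0 < δ ∧ ∀ (S : Type) [CommGroup S] [Fintype S] [DecidableEq S],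
      (∀ g : S, g ^ m = 1) →
      ∀ (σ : Type) [Fintype σ] (φ ψ : σ → S ≃* S) (N : ℕ)
        (α β γ : Fin (3 * N) × Fin (3 * N) → S),
      (∀ x y z : Fin (3 * N) × Fin (3 * N), (∃ s : σ, α x * φ s (β y) * ψ s (γ z) = 1) ↔
          (y.1 = x.2 ∧ z = (y.2, x.1))) →
      ((rothNumberNat N : ℝ) * N) ≤ 3 * (Fintype.card S : ℝ) ^ (1 - δ) := by
  obtain ⟨δ, hδ0, hmain⟩ := realization_expTwisted_inducedMatching_card_le m hm
  refine ⟨δ, hδ0, fun S _ _ _ hexpS σ _ φ ψ N α β γ hreal => ?_⟩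
  obtain ⟨t, htN, htcard, ht⟩ := rothNumberNat_spec N
  obtain ⟨a, b, c, -, hind⟩ := threeAPFree_inducedMatching ht htN
  have h := hmain S hexpS σ φ ψ (3 * N) α β γ hreal (↥t × Fin N) a b c hind
  have hcard : Fintype.card (↥t × Fin N) = rothNumberNat N * N := by
    rw [Fintype.card_prod, Fintype.card_coe, htcard, Fintype.card_fin]
  rw [hcard] at h
  exact_mod_cast h

/-- **Theorem B″, kernel form (Behrend).** For every `m ≥ 1` there is `δ > 0` such that a
Cohn–Umans realization of `⟨3N,3N,3N⟩` by the twisted triangle predicate of finitely many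
automorphism pairs `(φ_s, ψ_s)` of a finite abelian group `S` of exponent dividing `m` forces
`N² e^{-4√(log N)} ≤ 3 |S|^{1-δ}`: translation schemes over abelian groups of bounded exponent,
whatever the multiplier group, realize `⟨n,n,n⟩` only at size `|S| ≥ n^{(2-o(1))/(1-δ)}`.
[this work] -/
theorem realization_exp_card_ge_behrend (m : ℕ) (hm : 0 < m) :
    ∃ δ : ℝ, 0 < δ ∧ ∀ (S : Type) [CommGroup S] [Fintype S] [DecidableEq S],
      (∀ g : S, g ^ m = 1) →
      ∀ (σ : Type) [Fintype σ] (φ ψ : σ → S ≃* S) (N : ℕ)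
        (α β γ : Fin (3 * N) × Fin (3 * N) → S),
      (∀ x y z : Fin (3 * N) × Fin (3 * N), (∃ s : σ, α x * φ s (β y) * ψ s (γ z) = 1) ↔
          (y.1 = x.2 ∧ z = (y.2, x.1))) →
      ((N : ℝ) ^ 2 * Real.exp (-4 * Real.sqrt (Real.log N))) ≤
        3 * (Fintype.card S : ℝ) ^ (1 - δ) := by
  obtain ⟨δ, hδ0, hmain⟩ := realization_exp_card_ge_roth m hm
  refine ⟨δ, hδ0, fun S _ _ _ hexpS σ _ φ ψ N α β γ hreal => ?_⟩
  have h := hmain S hexpS σ φ ψ N α β γ hreal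
  have hB : (N : ℝ) * Real.exp (-4 * Real.sqrt (Real.log N)) ≤ rothNumberNat N :=
    Behrend.roth_lower_bound
  have hN : (0 : ℝ) ≤ N := Nat.cast_nonneg N
  calc (N : ℝ) ^ 2 * Real.exp (-4 * Real.sqrt (Real.log N))
      = ((N : ℝ) * Real.exp (-4 * Real.sqrt (Real.log N))) * N := by ring
    _ ≤ (rothNumberNat N : ℝ) * N := mul_le_mul_of_nonneg_right hB hN
    _ ≤ 3 * (Fintype.card S : ℝ) ^ (1 - δ) := h

/-- **The untwisted special case** (`M₀ = 1`: the abelian-group programme for groups of bounded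
exponent, cf. BCCGNSU 2017 / BCCGU 2017 Thm. 3.11, here with Behrend's constant): if
`α, β, γ : [3N]² → S` satisfy `α(x) β(y) γ(z) = 1 ⟺ (x,y,z)` is a matrix-multiplication triple,
`S` finite abelian with `g^m = 1`, then `N² e^{-4√(log N)} ≤ 3|S|^{1-δ(m)}`. [this work] -/
theorem tpp_exp_card_ge_behrend (m : ℕ) (hm : 0 < m) :
    ∃ δ : ℝ, 0 < δ ∧ ∀ (S : Type) [CommGroup S] [Fintype S] [DecidableEq S],
      (∀ g : S, g ^ m = 1) → ∀ (N : ℕ) (α β γ : Fin (3 * N) × Fin (3 * N) → S),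
      (∀ x y z : Fin (3 * N) × Fin (3 * N), α x * β y * γ z = 1 ↔
          (y.1 = x.2 ∧ z = (y.2, x.1))) →
      ((N : ℝ) ^ 2 * Real.exp (-4 * Real.sqrt (Real.log N))) ≤
        3 * (Fintype.card S : ℝ) ^ (1 - δ) := by
  obtain ⟨δ, hδ0, hmain⟩ := realization_exp_card_ge_behrend m hm
  refine ⟨δ, hδ0, fun S _ _ _ hexpS N α β γ htpp => ?_⟩
  refine hmain S hexpS Unit (fun _ => MulEquiv.refl S) (fun _ => MulEquiv.refl S) N α β γ ?_
  intro x y z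
  rw [← htpp x y z]
  simp only [MulEquiv.refl_apply, exists_const]

end Headline

end Summit.MatrixMultiplication.MatrixMultiplication.Theorems.TwistedSliceRank
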